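import Literature.Topology.FourManifolds.CuspCandidate
import Literature.Topology.FourManifolds.OneJetCriticalCurve
import Literature.Topology.FourManifolds.IntrinsicFoldCriterion
import HarnessLib

/-!
# Fold points of a smooth map: the pointwise condition, its invariance, fold-or-cusp dichotomy

Topic `Literature/Topology/FourManifolds` (programme of the fact
`Literature.Topology.FourManifolds.exists_isSimplifiedBrokenLefschetzFibration`, Baykur–Saeki 2017, §2.1:
the singularities of a generic map `X⁴ → Σ²` are folds and cusps).  A **fold point** of
`g : E → G` at `x` (Golubitsky–Guillemin III Def. 4.1, VI (2.1)(a)) is a point where `dg_x` is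
not onto and, for every non-zero cokernel covector `ℓ`, the kernel Hessian
`ℓ D²g(x)|_{Ker dg_x}` is nondegenerate.  This file records the pointwise condition, its
locality and its invariance under `C²` local diffeomorphisms of source and target (the
companion of `CuspCandidate.lean`), and the dichotomy at a rank-one critical point of a map to
the plane: fold point or cusp candidate (the cokernel is a line).

* `OneJet.IsFoldPointAt`, `isFoldPointAt_congr_of_eventuallyEq`, `isFoldPointAt_comp_iff`,
  `isFoldPointAt_comp_target_iff`;
* `OneJet.isFoldPointAt_or_isCuspCandidateAt`.

Everything is proved; `IsFoldPointAt` is the only definition; no named fact (D-0026).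

## References

* M. Golubitsky, V. Guillemin, *Stable Mappings and Their Singularities*, GTM 14 (1973), Ch. III
  §4, Def. 4.1; Ch. VI §2, (2.1). [GolubitskyGuillemin1973]
* R. İ. Baykur, O. Saeki, *Simplifying indefinite fibrations on 4-manifolds*, arXiv:1705.11169,
  §2.1, p. 6. [BaykurSaeki2017]
-/

noncomputable section

set_option maxSynthPendingDepth 2

open Set Function Filter Module
open scoped ContDiff Topology

namespace Literature.Topology.FourManifolds

namespace OneJet

section Fold

variable {E E' G G' : Type} [NormedAddCommGroup E] [NormedSpace ℝ E] [NormedAddCommGroup E']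
  [NormedSpace ℝ E'] [NormedAddCommGroup G] [NormedSpace ℝ G] [NormedAddCommGroup G']
  [NormedSpace ℝ G']

/-- **Fold point** (pointwise form): `dg_x` is not onto and for every cokernel covector `ℓ ≠ 0`
the kernel Hessian `ℓ D²g(x)|_{Ker dg_x}` is nondegenerate.
[cite: GolubitskyGuillemin1973, Ch. III §4, Def. 4.1; Ch. VI §2, (2.1)(a)] -/
def IsFoldPointAt (g : E → G) (x : E) : Prop :=
  ¬ Surjective (fderiv ℝ g x) ∧
    ∀ ℓ : G →L[ℝ] ℝ, ℓ ≠ 0 → ℓ.comp (fderiv ℝ g x) = 0 →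
      ∀ k₀ : E, fderiv ℝ g x k₀ = 0 →
        (∀ k, fderiv ℝ g x k = 0 → ℓ (fderiv ℝ (fderiv ℝ g) x k k₀) = 0) → k₀ = 0

/-- Unfolding `IsFoldPointAt`. [folklore] -/
theorem isFoldPointAt_iff (g : E → G) (x : E) :
    IsFoldPointAt g x ↔
      ¬ Surjective (fderiv ℝ g x) ∧
        ∀ ℓ : G →L[ℝ] ℝ, ℓ ≠ 0 → ℓ.comp (fderiv ℝ g x) = 0 →
          ∀ k₀ : E, fderiv ℝ g x k₀ = 0 →
            (∀ k, fderiv ℝ g x k = 0 → ℓ (fderiv ℝ (fderiv ℝ g) x k k₀) = 0) → k₀ = 0 :=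
  Iff.rfl

/-- Being a fold point depends only on the germ. [folklore] -/
theorem isFoldPointAt_congr_of_eventuallyEq {g₁ g₂ : E → G} {x : E} (heq : g₁ =ᶠ[𝓝 x] g₂) :
    IsFoldPointAt g₁ x ↔ IsFoldPointAt g₂ x := by
  rw [isFoldPointAt_iff, isFoldPointAt_iff, heq.fderiv_eq, heq.fderiv.fderiv_eq]

/-- **Fold points are invariant under reparametrisation of the source.** [folklore] -/
theorem isFoldPointAt_comp_iff {g : E → G} {θ : E' → E} {x : E'} (A : E' ≃L[ℝ] E)
    (hθ : HasFDerivAt θ (A : E' →L[ℝ] E) x) (hθ2 : ContDiffAt ℝ 2 θ x)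
    (hg2 : ContDiffAt ℝ 2 g (θ x)) :
    IsFoldPointAt (g ∘ θ) x ↔ IsFoldPointAt g (θ x) := by
  have hgd : DifferentiableAt ℝ g (θ x) := hg2.differentiableAt (by simp)
  have hfd : fderiv ℝ (g ∘ θ) x = (fderiv ℝ g (θ x)).comp (A : E' →L[ℝ] E) := by
    rw [fderiv_comp x hgd hθ.differentiableAt, hθ.fderiv]
  have hAθ : fderiv ℝ θ x = (A : E' →L[ℝ] E) := hθ.fderiv
  have hchain : ∀ (ℓ : G →L[ℝ] ℝ), ℓ.comp (fderiv ℝ g (θ x)) = 0 → ∀ v k : E',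
      ℓ (fderiv ℝ (fderiv ℝ (g ∘ θ)) x v k) = ℓ (fderiv ℝ (fderiv ℝ g) (θ x) (A v) (A k)) := by
    intro ℓ hℓ v k
    rw [fderiv_fderiv_comp_apply_eq_add hg2 hθ2 v k, map_add, hAθ]
    have : ℓ (fderiv ℝ g (θ x) (fderiv ℝ (fderiv ℝ θ) x v k)) = 0 := by
      simpa using congrArg (fun φ : E →L[ℝ] ℝ => φ (fderiv ℝ (fderiv ℝ θ) x v k)) hℓ
    rw [this, zero_add]
    rfl
  have hsurj : Surjective (fderiv ℝ (g ∘ θ) x) ↔ Surjective (fderiv ℝ g (θ x)) := by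
    rw [hfd]
    constructor
    · intro h w
      obtain ⟨v, hv⟩ := h w
      exact ⟨A v, hv⟩
    · intro h w
      obtain ⟨v, hv⟩ := h w
      exact ⟨A.symm v, by simpa using hv⟩
  have hcok : ∀ ℓ : G →L[ℝ] ℝ,
      ℓ.comp (fderiv ℝ (g ∘ θ) x) = 0 ↔ ℓ.comp (fderiv ℝ g (θ x)) = 0 := by
    intro ℓ
    rw [hfd]
    constructor
    · intro h
      ext u
      have := congrArg (fun φ : E' →L[ℝ] ℝ => φ (A.symm u)) h
      simpa using this
    · intro h
      rw [← ContinuousLinearMap.comp_assoc, h, ContinuousLinearMap.zero_comp]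
  rw [isFoldPointAt_iff, isFoldPointAt_iff, hsurj]
  refine and_congr_right fun _ => forall_congr' fun ℓ => forall_congr' fun _ => ?_
  rw [hcok ℓ]
  refine forall_congr' fun hℓg => ?_
  constructor
  · intro h k₀ hk₀ hrad
    have h1 := h (A.symm k₀) (by rw [hfd]; simpa using hk₀) fun k hk => by
      rw [hchain ℓ hℓg]
      have hk' : fderiv ℝ g (θ x) (A k) = 0 := by rw [hfd] at hk; exact hk
      simpa using hrad (A k) hk'
    simpa using congrArg A h1
  · intro h k₀ hk₀ hrad
    have hk₀' : fderiv ℝ g (θ x) (A k₀) = 0 := by rw [hfd] at hk₀; exact hk₀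
    have h1 := h (A k₀) hk₀' fun k hk => by
      have h2 := hrad (A.symm k) (by rw [hfd]; simpa using hk)
      rw [hchain ℓ hℓg] at h2
      simpa using h2
    exact A.injective (by rw [h1, map_zero])

/-- **Fold points are invariant under local diffeomorphisms of the target.** [folklore] -/
theorem isFoldPointAt_comp_target_iff {g : E → G} {ψ : G → G'} {x : E} (B : G ≃L[ℝ] G')
    (hψ : HasFDerivAt ψ (B : G →L[ℝ] G') (g x)) (hψ2 : ContDiffAt ℝ 2 ψ (g x))
    (hg2 : ContDiffAt ℝ 2 g x) :
    IsFoldPointAt (ψ ∘ g) x ↔ IsFoldPointAt g x := by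
  have hgd : DifferentiableAt ℝ g x := hg2.differentiableAt (by simp)
  have hfd : fderiv ℝ (ψ ∘ g) x = (B : G →L[ℝ] G').comp (fderiv ℝ g x) := by
    rw [fderiv_comp x hψ.differentiableAt hgd, hψ.fderiv]
  have hD2 : ∀ v k, fderiv ℝ g x k = 0 →
      fderiv ℝ (fderiv ℝ (ψ ∘ g)) x v k = B (fderiv ℝ (fderiv ℝ g) x v k) := fun v k hk => by
    rw [fderiv_fderiv_comp_apply_eq_add hψ2 hg2 v k, hψ.fderiv, hk, map_zero, add_zero]
    rfl
  have hker : ∀ k, fderiv ℝ (ψ ∘ g) x k = 0 ↔ fderiv ℝ g x k = 0 := fun k => by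
    rw [hfd, ContinuousLinearMap.comp_apply]
    exact ⟨fun h => B.injective (by simpa using h), fun h => by simp [h]⟩
  have hsurj : Surjective (fderiv ℝ (ψ ∘ g) x) ↔ Surjective (fderiv ℝ g x) := by
    rw [hfd]
    constructor
    · intro h w
      obtain ⟨v, hv⟩ := h (B w)
      exact ⟨v, B.injective (by simpa using hv)⟩
    · intro h w
      obtain ⟨v, hv⟩ := h (B.symm w)
      exact ⟨v, by simp [hv]⟩
  rw [isFoldPointAt_iff, isFoldPointAt_iff, hsurj]
  refine and_congr_right fun _ => ?_
  constructor
  · intro h ℓ hℓ hℓg k₀ hk₀ hrad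
    have hℓ' : ℓ.comp (B.symm : G' →L[ℝ] G) ≠ 0 := by
      intro h0
      apply hℓ
      ext w
      have := congrArg (fun φ : G' →L[ℝ] ℝ => φ (B w)) h0
      simpa using this
    have hℓg' : (ℓ.comp (B.symm : G' →L[ℝ] G)).comp (fderiv ℝ (ψ ∘ g) x) = 0 := by
      rw [hfd]
      ext w
      have := congrArg (fun φ : E →L[ℝ] ℝ => φ w) hℓg
      simpa using this
    refine h _ hℓ' hℓg' k₀ ((hker k₀).2 hk₀) fun k hk => ?_
    rw [hD2 k k₀ hk₀]
    simpa using hrad k ((hker k).1 hk)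
  · intro h ℓ' hℓ' hℓg' k₀ hk₀ hrad
    have hℓ : ℓ'.comp (B : G →L[ℝ] G') ≠ 0 := by
      intro h0
      apply hℓ'
      ext w
      have := congrArg (fun φ : G →L[ℝ] ℝ => φ (B.symm w)) h0
      simpa using this
    have hℓg : (ℓ'.comp (B : G →L[ℝ] G')).comp (fderiv ℝ g x) = 0 := by
      rw [ContinuousLinearMap.comp_assoc, ← hfd, hℓg']
    have hk₀' : fderiv ℝ g x k₀ = 0 := (hker k₀).1 hk₀
    refine h _ hℓ hℓg k₀ hk₀' fun k hk => ?_
    have h1 := hrad k ((hker k).2 hk)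
    rw [hD2 k k₀ hk₀'] at h1
    simpa using h1

end Fold

section Dichotomy

/-- Local notation for this file: the model space `ℝⁿ = EuclideanSpace ℝ (Fin n)`. -/
local notation "𝔼 " n:arg => EuclideanSpace ℝ (Fin n)

variable {E : Type} [NormedAddCommGroup E] [NormedSpace ℝ E]

/-- **Fold point or cusp candidate.**  At a critical point of a map to the plane with non-zero
differential (rank one), the cokernel is a line, so either every cokernel covector has a
nondegenerate kernel Hessian (fold point) or every one has a radical vector (cusp candidate).
[cite: GolubitskyGuillemin1973, Ch. VI §2, (2.1)] -/
theorem isFoldPointAt_or_isCuspCandidateAt {g : E → 𝔼 2} {x : E}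
    (hcrit : ¬ Surjective (fderiv ℝ g x)) (hne : fderiv ℝ g x ≠ 0) :
    IsFoldPointAt g x ∨ IsCuspCandidateAt g x := by
  obtain ⟨ℓ₀, hℓ₀, hℓ₀g⟩ := exists_ne_zero_comp_eq_zero hcrit
  -- every cokernel covector is a non-zero multiple of `ℓ₀`
  have he : ∃ e, fderiv ℝ g x e ≠ 0 := by
    by_contra h
    push Not at h
    exact hne (ContinuousLinearMap.ext fun e => by simpa using h e)
  obtain ⟨e, he⟩ := he
  have hℓ₀m : ℓ₀ (fderiv ℝ g x e) = 0 := by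
    simpa using congrArg (fun φ : E →L[ℝ] ℝ => φ e) hℓ₀g
  have hmult : ∀ ℓ : (𝔼 2) →L[ℝ] ℝ, ℓ ≠ 0 → ℓ.comp (fderiv ℝ g x) = 0 →
      ∃ a : ℝ, a ≠ 0 ∧ ℓ = a • ℓ₀ := by
    intro ℓ hℓ hℓg
    have hℓm : ℓ (fderiv ℝ g x e) = 0 := by
      simpa using congrArg (fun φ : E →L[ℝ] ℝ => φ e) hℓg
    obtain ⟨a, rfl⟩ := exists_eq_smul_covector hℓ₀ hℓ₀m he hℓm
    refine ⟨a, ?_, rfl⟩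
    rintro rfl
    exact hℓ (zero_smul _ _)
  by_cases hrad : ∃ k₀ : E, k₀ ≠ 0 ∧ fderiv ℝ g x k₀ = 0 ∧
      ∀ k, fderiv ℝ g x k = 0 → ℓ₀ (fderiv ℝ (fderiv ℝ g) x k k₀) = 0
  · -- cusp candidate
    obtain ⟨k₀, hk₀0, hk₀, hk₀rad⟩ := hrad
    refine Or.inr ⟨hcrit, fun ℓ hℓ hℓg => ?_⟩
    obtain ⟨a, -, rfl⟩ := hmult ℓ hℓ hℓg
    exact ⟨k₀, hk₀0, hk₀, fun k hk => by
      rw [_root_.smul_apply, hk₀rad k hk, smul_zero]⟩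
  · -- fold point
    push Not at hrad
    refine Or.inl ⟨hcrit, fun ℓ hℓ hℓg k₀ hk₀ hk₀rad => ?_⟩
    obtain ⟨a, ha, rfl⟩ := hmult ℓ hℓ hℓg
    by_contra hk₀0
    obtain ⟨k, hk, hk'⟩ := hrad k₀ hk₀0 hk₀
    apply hk'
    have h1 := hk₀rad k hk
    rw [_root_.smul_apply, smul_eq_mul, mul_eq_zero] at h1
    exact h1.resolve_left ha

end Dichotomy

end OneJet

end Literature.Topology.FourManifolds
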